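import Literature.AnabelianGeometry.EtaleTheta.Discharge.Sec5Cor512ModelCase
import Literature.AnabelianGeometry.EtaleTheta.Discharge.Sec5Cor512ModelCaseEndWitness
import Literature.AnabelianGeometry.SemiGraphs.TemperoidsGaloisProofs

/-!
# [EtTh] Corollary 5.12 (i)(iii) at the MODEL: the tacit input `End_D(B_N^bs) = Aut_D(B_N^bs)` DISCHARGED from
# «`B_N` is Galois» (Def. 4.1 (ii)) by [SemiAnbd] Remark 3.1.6

Mochizuki, *The étale theta function and its Frobenioid-theoretic manifestations*, Publ. RIMS **45** (2009),
Cor. 5.12 (i) p.339 (PDF p.113), proof p.340 l.−8 – p.341 l.9 (PDF pp.114–115); Def. 4.1 (ii) p.313 (PDF p.87):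
"We shall say that `A` is Galois if `A^bs ∈ Ob(D)` is Galois. Suppose that `A` is Galois. Then, by the definition of
`D`, there is a natural surjective outer homomorphism `Π^tp_X ↠ Aut_D(A^bs)`"; §5 p.331 (PDF p.105) l.39–41: "the
natural outer homomorphism `Π^tp_X ↠ Aut_D(B_N^bs)` [cf. Definition 4.1, (ii)]" — i.e. `B_N` IS Galois in §5
[cite: MochizukiEtTh2009, Cor 5.12 (i) p.339 (PDF p.113); Def 4.1 (ii) p.313 (PDF p.87); §5 p.331 (PDF p.105)].
Mochizuki, *Semi-graphs of anabelioids*, Publ. RIMS **42** (2006), Def. 3.1 (iv) p.33 (Galois objects), Remark 3.1.6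
p.34: "every endomorphism of a Galois connected object of a temperoid is an automorphism"
[cite: MochizukiSemiAnbd2006, Rmk 3.1.6 p.34].

PROOF-ONLY sequel (cell abc-iut, block F, seat abc-iut-f-112 gen 3; FACT-LIST rows F-0505 `ConstantMultiple.IsoClassesDistinct`,
F-0501 `ConstantMultipleIndeterminacy`, F-0502 `ConstantMultipleIndeterminacyOfSystems`) of this seat's gen-2 file
`Discharge/Sec5Cor512ModelCase.lean` (p436682).  There, Cor. 5.12 (i) at the model Frobenioid was proved from the inputs
print's proof names PLUS ONE input print does not name at that point, `hEnd : ∀ φ : B_N^bs ⟶ B_N^bs, IsIso φ` (needed so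
that "the isomorphism classes of these line bundles are preserved by arbitrary automorphisms of `B^bs_N`" applies to the
`D`-ENDOMORPHISM `h^bs ∘ β^bs`; `Discharge/Sec5Cor512ModelCaseEndWitness.lean`, p439672, shows it cannot be dropped).
Here `hEnd` is DISCHARGED from a property print DOES give the §5 data — `B_N` is Galois (Def. 4.1 (ii), used on p.331
for `Π^tp_X ↠ Aut_D(B_N^bs)`) — by [SemiAnbd] Remark 3.1.6, which the tree PROVES in any category for [SemiAnbd]
Def. 3.1 (iv)'s notion (`SemiGraphs.IsGaloisObj.isIso_of_endo`, abc-iut lineage `TemperoidsGaloisProofs.lean`; the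
named fact `EndOfGaloisIsIso` = F-1755 is `EndOfGaloisIsIso_holds`).  Two readings of «`B_N^bs` Galois» are served:
(a) Galois IN the base category `D` itself; (b) `D` a full subcategory `P.FullSubcategory` of a category `E` (the
genuine base `B^temp(Π^tp_X)⁰ = ConnectedPart (BTemp Π^tp_X)` of the tree's §5 data, whose settings read
`IsGaloisObj A := SemiGraphs.IsGaloisObj A.obj`) with `B_N^bs.obj` Galois in `E` — the fully faithful inclusion
reflects isomorphisms.  So at the model the hypotheses of Cor. 5.12 (i)/(iii)/(all) are now print's sentences ONLY:
`A_N` Frobenius-trivial, `B_N` Aut-ample and Galois, `Φ` divisorial, and the §1 line-bundle inputs `hL`, `hL'`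
(C512-L02; untyped MODEL inputs — they stay binders).  Consistency: at p439672's countermodel `hEnd` fails, so its
`B_N^bs` is not Galois (`Cor512EndToy.not_isGaloisObj_base_BN`).
No definition, no new `Prop`, no instance; nothing landed is edited or restated.  Cor. 5.12 is outside the
[IUTchIII] Cor. 3.12 cone; no side is taken on Cor. 3.12 or on any author; typed ≠ proved except the theorems below.
-/

namespace Literature.AnabelianGeometry.EtaleTheta

open CategoryTheory Opposite
open Literature.AlgebraicGeometry.Frobenioids
open Literature.AnabelianGeometry.SemiGraphs (IsGaloisObj)

universe w v u v' u' v'' u''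

/-! ### `End = Aut` for Galois objects, in the two readings -/

namespace ThetaFrobenioid

section AnyBase

variable {C : Type u} [Category.{v} C] {D : Type u'} [Category.{v'} D] (𝔉 : ThetaFrobenioid.{w} C D)

/-- **[SemiAnbd] Rmk. 3.1.6 at `B_N^bs`** (reading (a)): if `B_N^bs` is Galois in `D` ([EtTh] Def. 4.1 (ii); [SemiAnbd]
Def. 3.1 (iv)), every `D`-endomorphism of `B_N^bs` is an isomorphism — the tacit `hEnd` of `Sec5Cor512ModelCase`.
[cite: MochizukiSemiAnbd2006, Rmk 3.1.6 p.34] [cite: MochizukiEtTh2009, Def 4.1 (ii) p.313 (PDF p.87)] -/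
theorem isIso_endo_base_BN_of_isGaloisObj (hGal : IsGaloisObj (𝔉.base.obj 𝔉.BN))
    (φ : 𝔉.base.obj 𝔉.BN ⟶ 𝔉.base.obj 𝔉.BN) : IsIso φ :=
  hGal.isIso_of_endo φ

end AnyBase

section FullSubcategoryBase

variable {E : Type u''} [Category.{v''} E] {P : ObjectProperty E}

/-- **[SemiAnbd] Rmk. 3.1.6 through a full subcategory** (reading (b)): for an object `X` of a full subcategory
`P.FullSubcategory ⊆ E` whose underlying object `X.obj` is Galois in `E`, every endomorphism of `X` in the full
subcategory is an isomorphism (its image under the fully faithful inclusion is one, and the inclusion reflects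
isomorphisms).  This is the shape of the tree's genuine §5 base `B^temp(Π^tp_X)⁰ = ConnectedPart (BTemp Π^tp_X)`,
whose settings read "Galois" as `SemiGraphs.IsGaloisObj A.obj`.  [cite: MochizukiSemiAnbd2006, Rmk 3.1.6 p.34] -/
theorem isIso_endo_of_isGaloisObj_obj (X : P.FullSubcategory) (hGal : IsGaloisObj X.obj) (φ : X ⟶ X) : IsIso φ := by
  haveI : IsIso (P.ι.map φ) := hGal.isIso_of_endo φ.hom
  exact isIso_of_fully_faithful P.ι φ

variable {C : Type u} [Category.{v} C] (𝔉 : ThetaFrobenioid.{w} C P.FullSubcategory)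

/-- Reading (b) at `B_N^bs`: for §5 data over a full-subcategory base with `(B_N^bs).obj` Galois in the ambient category,
`End(B_N^bs) = Aut(B_N^bs)`.  [cite: MochizukiSemiAnbd2006, Rmk 3.1.6 p.34] [cite: MochizukiEtTh2009, §5 p.331 (PDF p.105)] -/
theorem isIso_endo_base_BN_of_isGaloisObj_obj (hGal : IsGaloisObj (𝔉.base.obj 𝔉.BN).obj)
    (φ : 𝔉.base.obj 𝔉.BN ⟶ 𝔉.base.obj 𝔉.BN) : IsIso φ :=
  isIso_endo_of_isGaloisObj_obj (𝔉.base.obj 𝔉.BN) hGal φ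

end FullSubcategoryBase

end ThetaFrobenioid

/-! ### Cor. 5.12 (i), (iii) and the whole Corollary at the MODEL with `hEnd` discharged -/

namespace ConstantMultiple

namespace RootMorphismData

section AnyBase

variable {D : Type u} [Category.{v} D] {Φ B : Dᵒᵖ ⥤ CommMonCat.{w}} {DivB : B ⟶ monoidGp Φ}
  {𝔉 : ThetaFrobenioid.{w} (ModelFrobenioid Φ B DivB) D} {V : FrobenioidThetaBiKummer.BiKummerVocabStub 𝔉}
  (R : RootMorphismData 𝔉 V)

/-- **[EtTh] Cor. 5.12 (i) at the MODEL, `hEnd` discharged** (F-0505 instance form): for §5 data over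
`ModelFrobenioid Φ B Div_B` whose operations are the model's, "The isomorphism classes of `A_N`, `B_N`, and `B_{N'}`
are distinct" from print's inputs ONLY — `Φ` divisorial, `A_N` Frobenius-trivial, `B_N` Aut-ample, **`B_N` Galois**
(Def. 4.1 (ii); in `D`), and the §1 line-bundle inputs `hL`, `hL'` ("all positive tensor powers of these line bundles
are nontrivial", p.341 l.5–6, in model form).  [cite: MochizukiEtTh2009, Cor 5.12 (i) p.339 (PDF p.113), proof p.340–341 (PDF pp.114–115)] -/
theorem isoClassesDistinct_of_model_of_isGaloisObj (h𝔉 : 𝔉.pre = PreFrobenioidData.ofModel Φ B DivB)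
    (hΦd : Objectwise (fun M _ => IsDivisorial M) Φ)
    (hA : 𝔉.IsFrobeniusTrivial 𝔉.AN) (hAmp : 𝔉.AutAmpleBN) (hGal : IsGaloisObj (𝔉.base.obj 𝔉.BN))
    (hL : ∀ u : B.obj (op 𝔉.BN.base), 𝔉.BN.cls ≠ divB Φ B DivB (op 𝔉.BN.base) u)
    (hL' : ∀ k : ℕ, 0 < k → ∀ u : B.obj (op R.BN'.base),
      R.BN'.cls ^ k ≠ divB Φ B DivB (op R.BN'.base) u) :
    IsoClassesDistinct R :=
  R.isoClassesDistinct_of_model h𝔉 hΦd hA hAmp (𝔉.isIso_endo_base_BN_of_isGaloisObj hGal) hL hL'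

/-- **[EtTh] Cor. 5.12 (iii) at the MODEL for every `ζ`, `hEnd` discharged** (F-0501 instance form), via abc-iut-L2-t4's
PROVED reduction `constantMultipleIndeterminacy_of`.  [cite: MochizukiEtTh2009, Cor 5.12 (iii) p.340 (PDF p.114), proof p.341 (PDF p.115)] -/
theorem constantMultipleIndeterminacy_of_model_of_isGaloisObj (h𝔉 : 𝔉.pre = PreFrobenioidData.ofModel Φ B DivB)
    (hΦd : Objectwise (fun M _ => IsDivisorial M) Φ)
    (hA : 𝔉.IsFrobeniusTrivial 𝔉.AN) (hAmp : 𝔉.AutAmpleBN) (hGal : IsGaloisObj (𝔉.base.obj 𝔉.BN))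
    (hL : ∀ u : B.obj (op 𝔉.BN.base), 𝔉.BN.cls ≠ divB Φ B DivB (op 𝔉.BN.base) u)
    (hL' : ∀ k : ℕ, 0 < k → ∀ u : B.obj (op R.BN'.base),
      R.BN'.cls ^ k ≠ divB Φ B DivB (op R.BN'.base) u)
    (ζ : R.BN' ⟶ 𝔉.BN) : ConstantMultipleIndeterminacy R ζ :=
  constantMultipleIndeterminacy_of R (R.isoClassesDistinct_of_model_of_isGaloisObj h𝔉 hΦd hA hAmp hGal hL hL') ζ

/-- **[EtTh] Cor. 5.12 — (i), (ii), (iii) — at the MODEL, `hEnd` discharged** (F-0502 instance form): print's inputs only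
(`Φ` divisorial, `B` group-like, `A_N`, `A_{N'}` Frobenius-trivial, `s^⊓_{N'}` a pre-step, `B_N` Aut-ample and Galois) and
the §1 line-bundle inputs `hL`, `hL'`.  [cite: MochizukiEtTh2009, Cor 5.12 p.339–341 (PDF pp.113–115)] -/
theorem constantMultipleIndeterminacyOfSystems_of_model_of_isGaloisObj
    (h𝔉 : 𝔉.pre = PreFrobenioidData.ofModel Φ B DivB)
    (hΦd : Objectwise (fun M _ => IsDivisorial M) Φ) (hBg : Objectwise (fun M _ => IsGroupLike M) B)
    (hA : 𝔉.IsFrobeniusTrivial 𝔉.AN) (hA' : 𝔉.IsFrobeniusTrivial R.AN') (hs' : 𝔉.IsPreStep R.sCap')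
    (hAmp : 𝔉.AutAmpleBN) (hGal : IsGaloisObj (𝔉.base.obj 𝔉.BN))
    (hL : ∀ u : B.obj (op 𝔉.BN.base), 𝔉.BN.cls ≠ divB Φ B DivB (op 𝔉.BN.base) u)
    (hL' : ∀ k : ℕ, 0 < k → ∀ u : B.obj (op R.BN'.base),
      R.BN'.cls ^ k ≠ divB Φ B DivB (op R.BN'.base) u) :
    ConstantMultipleIndeterminacyOfSystems R :=
  R.constantMultipleIndeterminacyOfSystems_of_model h𝔉 hΦd hBg hA hA' hs' hAmp
    (𝔉.isIso_endo_base_BN_of_isGaloisObj hGal) hL hL'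

end AnyBase

section FullSubcategoryBase

variable {E : Type u''} [Category.{v''} E] {P : ObjectProperty E}
  {Φ B : (P.FullSubcategory)ᵒᵖ ⥤ CommMonCat.{w}} {DivB : B ⟶ monoidGp Φ}
  {𝔉 : ThetaFrobenioid.{w} (ModelFrobenioid Φ B DivB) P.FullSubcategory}
  {V : FrobenioidThetaBiKummer.BiKummerVocabStub 𝔉} (R : RootMorphismData 𝔉 V)

/-- **Cor. 5.12 (i) at the MODEL over a full-subcategory base** (the shape of `B^temp(Π^tp_X)⁰`), `hEnd` discharged
from «`(B_N^bs).obj` is Galois in the ambient category» (reading (b)).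
[cite: MochizukiEtTh2009, Cor 5.12 (i) p.339 (PDF p.113)] [cite: MochizukiSemiAnbd2006, Rmk 3.1.6 p.34] -/
theorem isoClassesDistinct_of_model_of_isGaloisObj_obj (h𝔉 : 𝔉.pre = PreFrobenioidData.ofModel Φ B DivB)
    (hΦd : Objectwise (fun M _ => IsDivisorial M) Φ)
    (hA : 𝔉.IsFrobeniusTrivial 𝔉.AN) (hAmp : 𝔉.AutAmpleBN) (hGal : IsGaloisObj (𝔉.base.obj 𝔉.BN).obj)
    (hL : ∀ u : B.obj (op 𝔉.BN.base), 𝔉.BN.cls ≠ divB Φ B DivB (op 𝔉.BN.base) u)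
    (hL' : ∀ k : ℕ, 0 < k → ∀ u : B.obj (op R.BN'.base),
      R.BN'.cls ^ k ≠ divB Φ B DivB (op R.BN'.base) u) :
    IsoClassesDistinct R :=
  R.isoClassesDistinct_of_model h𝔉 hΦd hA hAmp (𝔉.isIso_endo_base_BN_of_isGaloisObj_obj hGal) hL hL'

/-- **Cor. 5.12 — (i), (ii), (iii) — at the MODEL over a full-subcategory base**, `hEnd` discharged (reading (b)).
[cite: MochizukiEtTh2009, Cor 5.12 p.339–341 (PDF pp.113–115)] [cite: MochizukiSemiAnbd2006, Rmk 3.1.6 p.34] -/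
theorem constantMultipleIndeterminacyOfSystems_of_model_of_isGaloisObj_obj
    (h𝔉 : 𝔉.pre = PreFrobenioidData.ofModel Φ B DivB)
    (hΦd : Objectwise (fun M _ => IsDivisorial M) Φ) (hBg : Objectwise (fun M _ => IsGroupLike M) B)
    (hA : 𝔉.IsFrobeniusTrivial 𝔉.AN) (hA' : 𝔉.IsFrobeniusTrivial R.AN') (hs' : 𝔉.IsPreStep R.sCap')
    (hAmp : 𝔉.AutAmpleBN) (hGal : IsGaloisObj (𝔉.base.obj 𝔉.BN).obj)
    (hL : ∀ u : B.obj (op 𝔉.BN.base), 𝔉.BN.cls ≠ divB Φ B DivB (op 𝔉.BN.base) u)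
    (hL' : ∀ k : ℕ, 0 < k → ∀ u : B.obj (op R.BN'.base),
      R.BN'.cls ^ k ≠ divB Φ B DivB (op R.BN'.base) u) :
    ConstantMultipleIndeterminacyOfSystems R :=
  R.constantMultipleIndeterminacyOfSystems_of_model h𝔉 hΦd hBg hA hA' hs' hAmp
    (𝔉.isIso_endo_base_BN_of_isGaloisObj_obj hGal) hL hL'

end FullSubcategoryBase

end RootMorphismData

/-! ### Consistency with the `hEnd`-separation countermodel (p439672) -/

namespace Cor512EndToy

/-- At this seat's countermodel `thetaEnd` / `rootEnd` (`Sec5Cor512ModelCaseEndWitness.lean`: every other binder holds,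
`hEnd` fails, (i) fails) the base object `B_N^bs` is NOT Galois in `D` — as it must be, by the discharge above.
[cite: MochizukiSemiAnbd2006, Rmk 3.1.6 p.34] [cite: MochizukiEtTh2009, Cor 5.12 (i) p.339 (PDF p.113)] -/
theorem not_isGaloisObj_base_BN : ¬ IsGaloisObj (thetaEnd.base.obj thetaEnd.BN) :=
  fun h => not_hEnd (thetaEnd.isIso_endo_base_BN_of_isGaloisObj h)

end Cor512EndToy

end ConstantMultiple

end Literature.AnabelianGeometry.EtaleTheta
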